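/-
Skeleton: cassels-tate-entries for crux stmt-BirchSwinnertonDyer-23431 (RamifiedJumpOneLevelTwoOfFacts)

Shape: B ⟺ AND of three Rédei-type CT entries. The level-two bit 2∥𝓛(n) is characterized
by the three entries of the Cassels–Tate pairing on V = Sel₂/κ(E[2]) ≅ 𝔽₂³, read through the
halving Bockstein of TYZ's genus decomposition.

Piece (G) = HalvingBockstein: DERIVED (structural in-tree), not asserted as a stub.

Stubs (2):
1. stub_TwoDividesScriptL — 2 | 𝓛(n) on jump-one class (M; TYZ + ρ ≥ 0)
2. stub_NotFourDividesScriptL — ¬(4 | 𝓛(n)) via CT entries (L; the research content)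

Stub 2 combines: (E) CT dichotomy + pin (p599547); (S) entries are Rédei symbols (Smith §2.4);
(G) HalvingBockstein ι_*κ₂(Q) = κ₄(2Q) (structural); (I) three entry laws:
  - Partner entry law (Zhao 2001, Wang 2016 Thm 3 — print)
  - Scholz entry law (Scholz reciprocity — print)
  - Top-period entry law (8-rank datum — HARDEST, research content)
The #Sel₄ = 2⁶ hypothesis ensures at least one entry ≠ 0, hence ¬(4 | L).

Composition: stub₁ ∧ stub₂ ⟹ RamifiedJumpOneLevelTwoOfFacts (kernel-checked)
-/
import Mathlib
import HarnessLib
import Summits.BirchSwinnertonDyer.BirchSwinnertonDyer.Theses.PrintCf2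
import Literature.NumberTheory.EllipticCurves.TianYuanZhang2017.GenusPeriodsParity

set_option autoImplicit false
set_option linter.dupNamespace false

namespace Summit.BirchSwinnertonDyer.BirchSwinnertonDyer.Cruxes.RamifiedJumpOneLevelTwoOfFacts

open Literature.NumberTheory.EllipticCurves TianYuanZhang2017

namespace CasselsTateEntries

/-! ## Stub 1: 2 | 𝓛(n) on the jump-one class -/

/-- stub_TwoDividesScriptL (M): On the jump-one class, 2 | 𝓛(n).
    From TYZ Thm 1.2 (tree: thm12_parity_of_scriptL'): 2^{1+ρ(n)} | 𝓛(n) with ρ(n) ≥ 0.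
    Source: TianYuanZhang2017 Thm 1.2, arXiv:1411.4728 p0002 L112–L127.
    Why it might fail: only if ρ(n) < 0, which contradicts the definition. -/
theorem stub_TwoDividesScriptL :
    ∀ (n : ℕ) [(congruentNumberCurve n).IsElliptic]
      [(congruentNumberCurve n).IsGloballyMinimal],
    Squarefree n →
    (n % 8 = 5 ∨ n % 8 = 6 ∨ n % 8 = 7) →
    (congruentNumberCurve n).analyticRank = 1 →
    Nat.card ((congruentNumberCurve n).selmerGroup 2) = 2 ^ 5 →
    Nat.card ((congruentNumberCurve n).selmerGroup 4) = 2 ^ 6 →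
    ∀ L : ℤ, IsScriptL n L → (2 : ℤ) ∣ L := by
  sorry

/-! ## Stub 2: ¬(4 | 𝓛(n)) via CT entries -/

/-- stub_NotFourDividesScriptL (L): On the jump-one class, ¬(4 | 𝓛(n)).
    The CT entry vector ≠ 0 (since #Sel₄ = 2⁶ ≠ 2⁸), so at least one of the three
    CT entries (partner, Scholz, top-period) is nonzero, and via HalvingBockstein
    that entry's obstruction prevents 4 | L.
    Source: p599547 (pin), Smith arXiv:1702.02325 §2.4, Zhao 2001, Wang 2016.
    Why it might fail: The top-period entry law is unprinted. -/
theorem stub_NotFourDividesScriptL :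
    ∀ (n : ℕ) [(congruentNumberCurve n).IsElliptic]
      [(congruentNumberCurve n).IsGloballyMinimal],
    Squarefree n →
    (n % 8 = 5 ∨ n % 8 = 6 ∨ n % 8 = 7) →
    (congruentNumberCurve n).analyticRank = 1 →
    Nat.card ((congruentNumberCurve n).selmerGroup 2) = 2 ^ 5 →
    Nat.card ((congruentNumberCurve n).selmerGroup 4) = 2 ^ 6 →
    ∀ L : ℤ, IsScriptL n L → ¬(4 : ℤ) ∣ L := by
  sorry

/-! ## Composition: stub₁ ∧ stub₂ ⟹ RamifiedJumpOneLevelTwoOfFacts -/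

/-- The composition theorem: from the two stubs we get RamifiedJumpOneLevelTwoOfFacts.
    Uses the stubs directly (no hypotheses), kernel-checked, no sorry of its own. -/
theorem RamifiedJumpOneLevelTwoOfFacts_of :
    Summit.BirchSwinnertonDyer.BirchSwinnertonDyer.Theses.PrintCf2.RamifiedJumpOneLevelTwoOfFacts := by
  intro n _ _ hsq h8 hrank hsel2 hsel4 L hL
  exact ⟨stub_TwoDividesScriptL n hsq h8 hrank hsel2 hsel4 L hL,
         stub_NotFourDividesScriptL n hsq h8 hrank hsel2 hsel4 L hL⟩

end CasselsTateEntries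

end Summit.BirchSwinnertonDyer.BirchSwinnertonDyer.Cruxes.RamifiedJumpOneLevelTwoOfFacts
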